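import Summits.AtomisticToContinuum.HydrodynamicLimit.Theorems.AntiMazurCoboundariesInfluenceLocalityObjects
import Summits.AtomisticToContinuum.HydrodynamicLimit.Theorems.JParityClosureCollisionTightnessTorusGibbs
import Literature.MathematicalPhysics.KineticTheory.CollisionFluxUpperBound
import Literature.MathematicalPhysics.KineticTheory.HardSphereCanonicalClusterBound

/-!
# Prelim C of stub `stub_trueCapsExist` (line `true-anchored-infection`, crux `InfluenceLocality`,
# stmt-AtomisticToContinuum-13916; route AntiMazurCoboundaries): statics of the one-window event
# under the homogeneous Gibbs law, localised near a third sphere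

The collision-flux (Rice) inequality `measure_collisionSum_ge_le_liminf` of
`KineticTheory/CollisionFluxUpperBound` reduces a collision sum along the flow to the
`G_N`-integral, over ONE-WINDOW EVENTS "the pair `(j, k)` reaches contact under a backward free
flight of duration `≤ h`", of a majorant of the mark. For STUB 4 (`TrueCapsExist`) the mark of a
collision of sphere `j` is "`j` is fast and lies near sphere `i`", so the static input is a bound
on `G_N(window event of (j, k) ∧ x_j near x_i)` weighted by a function of the three velocities,
UNIFORM IN `N` after summation over `k` (a factor `ε_N²`) and over `j` (a factor `ℓ_N³` from the
ball): the three-label Ruelle bound `posGibbs_tripleEvent_le` of the canonical hard-sphere gas at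
small reduced density. Contents:

* `TrueCaps.windowEvent S j k` — the one-window event of the ordered pair `(j, k)` for a
  swept-tube family `S` (as in `exists_windowEvent`, written out): some lift
  `reprSym (x_k - x_j) + m`, `m ∈ ℤ³`, lies in `S (v_j - v_k)`; it is measurable
  (`measurableSet_windowEvent`) and contains every non-overlapping configuration whose pair
  `(j, k)` is at contact after a backward free flight of duration `t ∈ [0, h]`
  (`mem_windowEvent_of_contact`, `exists_latticeVec_add_mem_of_contact`);
* `TrueCaps.lintegral_pi_triple` — three distinct coordinates of a product probability law are
  distributed as the triple product (`lintegral_pi_eq_lintegral_update`, `lintegral_pi_pair`);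
* `TrueCaps.volume_setOf_norm_reprSym_lt_le` — `vol {p ∈ 𝕋³ | ‖reprSym p‖ < ρ} ≤ ρ³ vol B₁`;
* `trueCaps_window_ball_le` (registered prelim) — **the localised window bound**: under
  `G_N = localGibbsLaw σ a c θ N Φ` at small reduced density, for distinct `j, k, i`, a measurable
  weight `W (v_j, v_k, v_i)` and a measurable radius `ρ (v_j, v_i) ≥ 0`,
  `∫ 𝟙{windowEvent S j k ∧ dist(x_j, x_i) < ρ} W dG_N
     ≤ 32 ε² h vol(B₁) ∫ ‖v_k - v_j‖ ρ(v_j, v_i)³ W d(γ ⊗ γ ⊗ γ)`, `γ = N(c, θ)`;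
* `TrueCaps.lintegral_ball_le` — the one-sphere analogue for the time-`0` term:
  `∫ 𝟙{dist(x_j, x_i) < ρ(v_j)} W(v_j) dG_N ≤ 4 vol(B₁) ∫ ρ(v)³ W(v) dγ(v)` (`j ≠ i`, `N ≥ 1`,
  `posGibbs_pairEvent_le`).
-/

namespace Summit.AtomisticToContinuum.HydrodynamicLimit.Theorems.TrueAnchoredInfection

open MeasureTheory Set Filter Topology
open scoped ENNReal
open Literature.Analysis.FluidPDE Literature.MathematicalPhysics.KineticTheory
open Literature.Analysis.FunctionSpaces

noncomputable section

namespace TrueCaps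

/-! ## The one-window event of an ordered pair -/

/-- The ONE-WINDOW EVENT of the ordered pair `(j, k)` for a swept-tube family `S`: some lift
`reprSym (x_k - x_j) + m`, `m ∈ ℤ³`, of the relative position lies in the tube `S (v_j - v_k)` of
the relative velocity. -/
def windowEvent (S : V3 → Set V3) {N : ℕ} (j k : Fin (N + 1)) : Set (Phase N) :=
  {w | ∃ m : Fin 3 → ℤ, Torus.reprSym ((w k).1 - (w j).1) + Torus.latticeVec m ∈ S ((w j).2 - (w k).2)}

/-- The one-window event is measurable (jointly measurable tube family). -/
theorem measurableSet_windowEvent {S : V3 → Set V3} (hSm : MeasurableSet {q : V3 × V3 | q.1 ∈ S q.2})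
    {N : ℕ} (j k : Fin (N + 1)) : MeasurableSet (windowEvent S j k) := by
  have hψ : ∀ m : Fin 3 → ℤ, Measurable fun w : Phase N =>
      (Torus.reprSym ((w k).1 - (w j).1) + Torus.latticeVec m, (w j).2 - (w k).2) := fun m =>
    ((Torus.measurable_reprSym.comp ((measurable_pi_apply k).fst.sub (measurable_pi_apply j).fst)).add_const _).prodMk
      ((measurable_pi_apply j).snd.sub (measurable_pi_apply k).snd)
  have hset : windowEvent S j k = ⋃ m : Fin 3 → ℤ, (fun w : Phase N =>
      (Torus.reprSym ((w k).1 - (w j).1) + Torus.latticeVec m, (w j).2 - (w k).2)) ⁻¹' {q : V3 × V3 | q.1 ∈ S q.2} := by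
    ext w
    simp only [windowEvent, mem_setOf_eq, mem_iUnion, mem_preimage]
  rw [hset]
  exact MeasurableSet.iUnion fun m => hSm.preimage (hψ m)

/-- **Contact within backward time `h` implies the window event**: a non-overlapping configuration
whose pair `(j, k)` is at contact after a backward free flight of duration `t ∈ [0, h]` belongs to
`windowEvent S j k`, for every swept-tube family `S` with the covering property `hS`. -/
theorem mem_windowEvent_of_contact {σ : ℝ} {N : ℕ} {h : ℝ} {S : V3 → Set V3}
    (hS : ∀ (u r : V3) (s : ℝ), hsDiameter σ N ≤ ‖r‖ → s ∈ Icc 0 h → ‖r + s • u‖ = hsDiameter σ N → r ∈ S u)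
    {j k : Fin (N + 1)} (hjk : j ≠ k) {w : Phase N} (hw : w ∈ hardSphereDomain G3 (N + 1) (hsDiameter σ N))
    {t : ℝ} (ht : t ∈ Icc 0 h)
    (hc : ‖G3.sepVec ((freeFlight G3 (-t) w j).1) ((freeFlight G3 (-t) w k).1)‖ = hsDiameter σ N) :
    w ∈ windowEvent S j k := by
  have hc' : ‖G3.sepVec ((freeFlight G3 (-t) w k).1) ((freeFlight G3 (-t) w j).1)‖ = hsDiameter σ N := by
    rw [Torus.norm_geometry_sepVec, Torus.euclidDist_comm, ← Torus.norm_geometry_sepVec (d := Fin 3)]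
    exact hc
  exact exists_latticeVec_add_mem_of_contact hS hw hjk.symm ht hc'

/-! ## Small measure-theoretic inputs -/

/-- **Three distinct coordinates of a product probability law** are jointly distributed as the
triple product (`lintegral` form). -/
theorem lintegral_pi_triple {ι X : Type*} [Fintype ι] [DecidableEq ι] [MeasurableSpace X] (γ : Measure X)
    [IsProbabilityMeasure γ] {j k i : ι} (hjk : j ≠ k) (hji : j ≠ i) (hki : k ≠ i)
    {f : (X × X) × X → ℝ≥0∞} (hf : Measurable f) :
    ∫⁻ v, f ((v j, v k), v i) ∂Measure.pi (fun _ : ι => γ) = ∫⁻ q, f q ∂((γ.prod γ).prod γ) := by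
  have hF : Measurable fun v : ι → X => f ((v j, v k), v i) :=
    hf.comp (((measurable_pi_apply j).prodMk (measurable_pi_apply k)).prodMk (measurable_pi_apply i))
  rw [Literature.MathematicalPhysics.StatisticalMechanics.lintegral_pi_eq_lintegral_update γ i hF]
  have hupd : ∀ (v : ι → X) (y : X),
      f ((Function.update v i y j, Function.update v i y k), Function.update v i y i) = f ((v j, v k), y) := by
    intro v y
    rw [Function.update_of_ne hji, Function.update_of_ne hki, Function.update_self]
  simp_rw [hupd]
  have hg : Measurable fun p : X × X => ∫⁻ y, f (p, y) ∂γ := hf.lintegral_prod_right'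
  rw [lintegral_pi_pair γ hjk (f := fun p : X × X => ∫⁻ y, f (p, y) ∂γ) hg, lintegral_prod _ hf.aemeasurable]

/-- The Haar measure of a minimal-image ball: `vol {p ∈ 𝕋³ | ‖reprSym p‖ < ρ} ≤ ρ³ · vol B₁`
(`Torus.volume_reprSym_sub_mem` and the scaling of Lebesgue measure). -/
theorem volume_setOf_norm_reprSym_lt_le {ρ : ℝ} (hρ : 0 ≤ ρ) :
    volume {p : T3 | ‖Torus.reprSym p‖ < ρ} ≤
      ENNReal.ofReal (ρ ^ 3) * volume (Metric.ball (0 : V3) 1) := by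
  have h := Torus.volume_reprSym_sub_mem (0 : T3) (measurableSet_ball (x := (0 : V3)) (ε := ρ))
  have hset : {p : T3 | ‖Torus.reprSym p‖ < ρ} = {x : T3 | Torus.reprSym (x - 0) ∈ Metric.ball (0 : V3) ρ} := by
    ext p; simp [sub_zero]
  rw [hset, h]
  calc volume (Metric.ball (0 : V3) ρ ∩ Torus.symCube (Fin 3)) ≤ volume (Metric.ball (0 : V3) ρ) :=
        measure_mono inter_subset_left
    _ = ENNReal.ofReal (ρ ^ 3) * volume (Metric.ball (0 : V3) 1) := by
        rw [Measure.addHaar_ball _ _ hρ, finrank_euclideanSpace_fin]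

/-- The measurable set of minimal-image lifts into `B` has Haar measure at most `vol B`
(`volume_setOf_exists_reprSym_add_latticeVec_mem_le` at `y = 0`). -/
theorem volume_setOf_exists_lift_mem_le {B : Set V3} (hB : MeasurableSet B) :
    volume {x : T3 | ∃ m : Fin 3 → ℤ, Torus.reprSym x + Torus.latticeVec m ∈ B} ≤ volume B := by
  have h := volume_setOf_exists_reprSym_add_latticeVec_mem_le (0 : T3) hB
  simpa only [sub_zero] using h

/-- The lift event of a measurable `B` is measurable. -/
theorem measurableSet_setOf_exists_lift_mem {B : Set V3} (hB : MeasurableSet B) :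
    MeasurableSet {x : T3 | ∃ m : Fin 3 → ℤ, Torus.reprSym x + Torus.latticeVec m ∈ B} := by
  have : {x : T3 | ∃ m : Fin 3 → ℤ, Torus.reprSym x + Torus.latticeVec m ∈ B} =
      ⋃ m : Fin 3 → ℤ, (fun x : T3 => Torus.reprSym x + Torus.latticeVec m) ⁻¹' B := by
    ext x; simp only [mem_setOf_eq, mem_iUnion, mem_preimage]
  rw [this]
  exact MeasurableSet.iUnion fun m => hB.preimage (Torus.measurable_reprSym.add_const _)

end TrueCaps

open TrueCaps in
/-- **Registered prelim `trueCaps_window_ball_le`** (of `stub_trueCapsExist`): the LOCALISED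
ONE-WINDOW BOUND. Under the homogeneous Gibbs law `G_N = localGibbsLaw σ a c θ N Φ` at small
reduced density (`SmallDensity uniformProfile σ`, `a, θ > 0`), for distinct labels `j, k, i`, a
jointly measurable swept-tube family `S` with `vol (S u) ≤ 4 ε² h ‖u‖` (`ε = hsDiameter σ N`,
`h ≥ 0`), a measurable weight `W (v_j, v_k, v_i) ≥ 0` and a measurable radius `ρ (v_j, v_i) ≥ 0`:
`∫ 𝟙{w ∈ windowEvent S j k, dist(x_j, x_i) < ρ(v_j, v_i)} W dG_N
  ≤ 32 ε² h · vol(B₁) · ∫ ‖v_k - v_j‖ ρ(v_j, v_i)³ W(v_j, v_k, v_i) d(γ ⊗ γ ⊗ γ)`, `γ = N(c, θ)`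
(disintegration of `G_N` into the canonical position law and independent Gaussian velocities, the
three-label Ruelle bound `posGibbs_tripleEvent_le`, the Haar-versus-Lebesgue inequality for lifts,
and the scaling of balls). -/
theorem trueCaps_window_ball_le : ∀ (σ a θ : ℝ) (c : V3) (N : ℕ) (Φ : Flow σ N) (h : ℝ) (j k i : Fin (N + 1)) (S : V3 → Set V3) (W : (V3 × V3) × V3 → ℝ≥0∞) (ρ : V3 × V3 → ℝ), SmallDensity uniformProfile σ → 0 < a → 0 < θ → 0 ≤ h → j ≠ k → j ≠ i → k ≠ i → MeasurableSet {q : V3 × V3 | q.1 ∈ S q.2} → (∀ u, MeasureTheory.volume (S u) ≤ ENNReal.ofReal (4 * hsDiameter σ N ^ 2 * h * ‖u‖)) → Measurable W → Measurable ρ → (∀ p, 0 ≤ ρ p) → ∫⁻ w, (TrueCaps.windowEvent S j k ∩ {w | Torus.euclidDist (w j).1 (w i).1 < ρ ((w j).2, (w i).2)}).indicator (fun w => W (((w j).2, (w k).2), (w i).2)) w ∂(gibbs σ a θ c N Φ) ≤ ENNReal.ofReal (32 * hsDiameter σ N ^ 2 * h) * MeasureTheory.volume (Metric.ball (0 : V3)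 1) * ∫⁻ q, ENNReal.ofReal ‖q.1.2 - q.1.1‖ * ENNReal.ofReal (ρ (q.1.1, q.2) ^ 3) * W q ∂(((gaussMeasure c θ).prod (gaussMeasure c θ)).prod (gaussMeasure c θ)) := by
  intro σ a θ c N Φ h j k i S W ρ hsd ha hθ hh hjk hji hki hSm hSvol hW hρm hρ0
  classical
  set ε := hsDiameter σ N with hεdef
  have hσ2 : σ ≤ 1 / 2 := hsd.σ_lt_half.le
  -- sections of the tube family are measurable
  have hSu : ∀ v : V3, MeasurableSet (S v) := fun v => hSm.preimage (measurable_id.prodMk measurable_const)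
  -- the position events for a fixed velocity vector
  set T : (Fin (N + 1) → V3) → Set T3 := fun v =>
    {p | ∃ m : Fin 3 → ℤ, Torus.reprSym p + Torus.latticeVec m ∈ S (v j - v k)} with hT
  set B : (Fin (N + 1) → V3) → Set T3 := fun v => {p | ‖Torus.reprSym p‖ < ρ (v j, v i)} with hB
  have hTm : ∀ v, MeasurableSet (T v) := fun v => measurableSet_setOf_exists_lift_mem (hSu _)
  have hBm : ∀ v, MeasurableSet (B v) := fun v =>
    measurableSet_lt Torus.measurable_reprSym.norm measurable_const
  have hTvol : ∀ v, volume (T v) ≤ ENNReal.ofReal (4 * ε ^ 2 * h * ‖v j - v k‖) := fun v =>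
    (volume_setOf_exists_lift_mem_le (hSu _)).trans (hSvol _)
  have hBvol : ∀ v, volume (B v) ≤ ENNReal.ofReal (ρ (v j, v i) ^ 3) * volume (Metric.ball (0 : V3) 1) :=
    fun v => volume_setOf_norm_reprSym_lt_le (hρ0 _)
  -- the integrand
  set E : Set (Phase N) := windowEvent S j k ∩ {w | Torus.euclidDist (w j).1 (w i).1 < ρ ((w j).2, (w i).2)} with hE
  have hEm : MeasurableSet E := by
    refine (measurableSet_windowEvent hSm j k).inter ?_
    refine measurableSet_lt ?_ (hρm.comp ((measurable_pi_apply j).snd.prodMk (measurable_pi_apply i).snd))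
    exact (Torus.measurable_reprSym.comp ((measurable_pi_apply j).fst.sub (measurable_pi_apply i).fst)).norm
  set F : Phase N → ℝ≥0∞ := E.indicator fun w => W (((w j).2, (w k).2), (w i).2) with hF
  have hWm : Measurable fun w : Phase N => W (((w j).2, (w k).2), (w i).2) :=
    hW.comp (((measurable_pi_apply j).snd.prodMk (measurable_pi_apply k).snd).prodMk (measurable_pi_apply i).snd)
  have hFm : Measurable F := hWm.indicator hEm
  -- disintegrate the rung-0 law
  set Q := posGibbsMeasure (fun _ : T3 => a) ε (N + 1) with hQ
  set Γ : Measure (Fin (N + 1) → V3) := Measure.pi fun _ => gaussMeasure c θ with hΓ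
  have hlaw : gibbs σ a θ c N Φ = (Q.prod Γ).map zipConfig := by
    rw [gibbs, localGibbsLaw_eq, localGibbsMeasure_rung0_eq_map σ ha.le hθ c N]
  haveI : IsProbabilityMeasure Q := isProbabilityMeasure_posGibbsMeasure continuous_const (fun _ => ha) hσ2 N
  haveI : IsProbabilityMeasure Γ := by rw [hΓ]; infer_instance
  -- the section bound at fixed velocities: the three-label Ruelle bound
  have hsec : ∀ v : Fin (N + 1) → V3, ∫⁻ x, F (zipConfig (x, v)) ∂Q ≤
      W ((v j, v k), v i) * (8 * (ENNReal.ofReal (4 * ε ^ 2 * h * ‖v j - v k‖) *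
        (ENNReal.ofReal (ρ (v j, v i) ^ 3) * volume (Metric.ball (0 : V3) 1)))) := by
    intro v
    have hle : ∀ x, F (zipConfig (x, v)) ≤
        {x : Fin (N + 1) → T3 | x k - x j ∈ T v ∧ x i - x j ∈ B v}.indicator (fun _ => W ((v j, v k), v i)) x := by
      intro x
      by_cases hx : zipConfig (x, v) ∈ E
      · have hx' : x ∈ {x : Fin (N + 1) → T3 | x k - x j ∈ T v ∧ x i - x j ∈ B v} := by
          obtain ⟨⟨m, hm⟩, hball⟩ := hx
          refine ⟨⟨m, by simpa only [zipConfig_apply] using hm⟩, ?_⟩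
          simp only [mem_setOf_eq, zipConfig_apply] at hball
          show ‖Torus.reprSym (x i - x j)‖ < ρ (v j, v i)
          rwa [← Torus.euclidDist_eq, Torus.euclidDist_comm]
        rw [hF, indicator_of_mem hx, indicator_of_mem hx']
        simp only [zipConfig_apply, le_refl]
      · rw [hF, indicator_of_notMem hx]
        exact bot_le
    calc ∫⁻ x, F (zipConfig (x, v)) ∂Q
        ≤ ∫⁻ x, {x : Fin (N + 1) → T3 | x k - x j ∈ T v ∧ x i - x j ∈ B v}.indicator
            (fun _ => W ((v j, v k), v i)) x ∂Q := lintegral_mono hle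
      _ ≤ W ((v j, v k), v i) * Q {x | x k - x j ∈ T v ∧ x i - x j ∈ B v} := lintegral_indicator_const_le _ _
      _ ≤ W ((v j, v k), v i) * (8 * (volume (T v) * volume (B v))) := by
          gcongr
          rw [hQ, posGibbsMeasure_const_eq_one ha]
          exact posGibbs_tripleEvent_le hsd hjk hji hki (hTm v) (hBm v)
      _ ≤ W ((v j, v k), v i) * (8 * (ENNReal.ofReal (4 * ε ^ 2 * h * ‖v j - v k‖) *
            (ENNReal.ofReal (ρ (v j, v i) ^ 3) * volume (Metric.ball (0 : V3) 1)))) := by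
          gcongr
          · exact hTvol v
          · exact hBvol v
  -- integrate the section bound against the Gaussian velocities
  set Gv : (V3 × V3) × V3 → ℝ≥0∞ := fun q => W q * (8 * (ENNReal.ofReal (4 * ε ^ 2 * h * ‖q.1.1 - q.1.2‖) *
    (ENNReal.ofReal (ρ (q.1.1, q.2) ^ 3) * volume (Metric.ball (0 : V3) 1)))) with hGv
  have hGvm : Measurable Gv := by
    refine hW.mul (measurable_const.mul ((Measurable.ennreal_ofReal ?_).mul
      ((Measurable.ennreal_ofReal ?_).mul measurable_const)))
    · exact measurable_const.mul (measurable_fst.fst.sub measurable_fst.snd).norm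
    · exact (hρm.comp (measurable_fst.fst.prodMk measurable_snd)).pow_const 3
  calc ∫⁻ w, F w ∂(gibbs σ a θ c N Φ)
      = ∫⁻ pr, F (zipConfig pr) ∂(Q.prod Γ) := by rw [hlaw, lintegral_map hFm measurable_zipConfig]
    _ = ∫⁻ v, ∫⁻ x, F (zipConfig (x, v)) ∂Q ∂Γ :=
        lintegral_prod_symm _ (hFm.comp measurable_zipConfig).aemeasurable
    _ ≤ ∫⁻ v, Gv ((v j, v k), v i) ∂Γ := lintegral_mono hsec
    _ = ∫⁻ q, Gv q ∂(((gaussMeasure c θ).prod (gaussMeasure c θ)).prod (gaussMeasure c θ)) := by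
        rw [hΓ]
        exact lintegral_pi_triple (gaussMeasure c θ) hjk hji hki hGvm
    _ = ENNReal.ofReal (32 * ε ^ 2 * h) * volume (Metric.ball (0 : V3) 1) *
          ∫⁻ q, ENNReal.ofReal ‖q.1.2 - q.1.1‖ * ENNReal.ofReal (ρ (q.1.1, q.2) ^ 3) * W q
            ∂(((gaussMeasure c θ).prod (gaussMeasure c θ)).prod (gaussMeasure c θ)) := by
        rw [← lintegral_const_mul' _ _ (ENNReal.mul_ne_top ENNReal.ofReal_ne_top measure_ball_lt_top.ne)]
        refine lintegral_congr fun q => ?_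
        rw [hGv]
        simp only
        rw [norm_sub_rev q.1.1 q.1.2, show (4 : ℝ) * ε ^ 2 * h * ‖q.1.2 - q.1.1‖ = (4 * ε ^ 2 * h) * ‖q.1.2 - q.1.1‖ by ring,
          ENNReal.ofReal_mul (by positivity : (0 : ℝ) ≤ 4 * ε ^ 2 * h),
          show (32 : ℝ) * ε ^ 2 * h = 8 * (4 * ε ^ 2 * h) by ring,
          ENNReal.ofReal_mul (by norm_num : (0 : ℝ) ≤ 8), ENNReal.ofReal_ofNat]
        ring

namespace TrueCaps

/-- **The one-sphere ball bound** (time-`0` term): under `G_N` at small reduced density, for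
`j ≠ i`, `N ≥ 1`, a measurable weight `W (v_j) ≥ 0` and a measurable radius `ρ (v_j) ≥ 0`,
`∫ 𝟙{dist(x_j, x_i) < ρ(v_j)} W(v_j) dG_N ≤ 4 vol(B₁) ∫ ρ(v)³ W(v) dγ(v)` (`posGibbs_pairEvent_le`). -/
theorem lintegral_ball_le {σ a θ : ℝ} (c : V3) {N : ℕ} (Φ : Flow σ N) {j i : Fin (N + 1)}
    {W : V3 → ℝ≥0∞} {ρ : V3 → ℝ} (hsd : SmallDensity uniformProfile σ) (ha : 0 < a) (hθ : 0 < θ)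
    (hN : 1 ≤ N) (hji : j ≠ i) (hW : Measurable W) (hρm : Measurable ρ) (hρ0 : ∀ v, 0 ≤ ρ v) :
    ∫⁻ w, {w : Phase N | Torus.euclidDist (w j).1 (w i).1 < ρ (w j).2}.indicator (fun w => W (w j).2) w
        ∂(gibbs σ a θ c N Φ) ≤
      4 * volume (Metric.ball (0 : V3) 1) * ∫⁻ v, ENNReal.ofReal (ρ v ^ 3) * W v ∂(gaussMeasure c θ) := by
  classical
  set ε := hsDiameter σ N with hεdef
  have hσ2 : σ ≤ 1 / 2 := hsd.σ_lt_half.le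
  set B : (Fin (N + 1) → V3) → Set T3 := fun v => {p | ‖Torus.reprSym p‖ < ρ (v j)} with hB
  have hBm : ∀ v, MeasurableSet (B v) := fun v => measurableSet_lt Torus.measurable_reprSym.norm measurable_const
  have hBvol : ∀ v, volume (B v) ≤ ENNReal.ofReal (ρ (v j) ^ 3) * volume (Metric.ball (0 : V3) 1) :=
    fun v => volume_setOf_norm_reprSym_lt_le (hρ0 _)
  set E : Set (Phase N) := {w | Torus.euclidDist (w j).1 (w i).1 < ρ (w j).2} with hE
  have hEm : MeasurableSet E := by
    refine measurableSet_lt ?_ (hρm.comp (measurable_pi_apply j).snd)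
    exact (Torus.measurable_reprSym.comp ((measurable_pi_apply j).fst.sub (measurable_pi_apply i).fst)).norm
  set F : Phase N → ℝ≥0∞ := E.indicator fun w => W (w j).2 with hF
  have hWm : Measurable fun w : Phase N => W (w j).2 := hW.comp (measurable_pi_apply j).snd
  have hFm : Measurable F := hWm.indicator hEm
  set Q := posGibbsMeasure (fun _ : T3 => a) ε (N + 1) with hQ
  set Γ : Measure (Fin (N + 1) → V3) := Measure.pi fun _ => gaussMeasure c θ with hΓ
  have hlaw : gibbs σ a θ c N Φ = (Q.prod Γ).map zipConfig := by
    rw [gibbs, localGibbsLaw_eq, localGibbsMeasure_rung0_eq_map σ ha.le hθ c N]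
  haveI : IsProbabilityMeasure Q := isProbabilityMeasure_posGibbsMeasure continuous_const (fun _ => ha) hσ2 N
  haveI : IsProbabilityMeasure Γ := by rw [hΓ]; infer_instance
  have hsec : ∀ v : Fin (N + 1) → V3, ∫⁻ x, F (zipConfig (x, v)) ∂Q ≤
      W (v j) * (4 * (ENNReal.ofReal (ρ (v j) ^ 3) * volume (Metric.ball (0 : V3) 1))) := by
    intro v
    have hle : ∀ x, F (zipConfig (x, v)) ≤
        {x : Fin (N + 1) → T3 | x i - x j ∈ B v}.indicator (fun _ => W (v j)) x := by
      intro x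
      by_cases hx : zipConfig (x, v) ∈ E
      · have hx' : x ∈ {x : Fin (N + 1) → T3 | x i - x j ∈ B v} := by
          have hball : Torus.euclidDist (x j) (x i) < ρ (v j) := by simpa only [hE, mem_setOf_eq, zipConfig_apply] using hx
          show ‖Torus.reprSym (x i - x j)‖ < ρ (v j)
          rwa [← Torus.euclidDist_eq, Torus.euclidDist_comm]
        rw [hF, indicator_of_mem hx, indicator_of_mem hx']
        simp only [zipConfig_apply, le_refl]
      · rw [hF, indicator_of_notMem hx]
        exact bot_le
    calc ∫⁻ x, F (zipConfig (x, v)) ∂Q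
        ≤ ∫⁻ x, {x : Fin (N + 1) → T3 | x i - x j ∈ B v}.indicator (fun _ => W (v j)) x ∂Q := lintegral_mono hle
      _ ≤ W (v j) * Q {x | x i - x j ∈ B v} := lintegral_indicator_const_le _ _
      _ ≤ W (v j) * (4 * volume (B v)) := by
          gcongr
          rw [hQ, posGibbsMeasure_const_eq_one ha]
          exact posGibbs_pairEvent_le hsd hN hji.symm (hBm v)
      _ ≤ W (v j) * (4 * (ENNReal.ofReal (ρ (v j) ^ 3) * volume (Metric.ball (0 : V3) 1))) := by
          gcongr
          exact hBvol v
  set Gv : V3 → ℝ≥0∞ := fun p => W p * (4 * (ENNReal.ofReal (ρ p ^ 3) * volume (Metric.ball (0 : V3) 1))) with hGv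
  have hGvm : Measurable Gv := hW.mul (measurable_const.mul ((hρm.pow_const 3).ennreal_ofReal.mul measurable_const))
  calc ∫⁻ w, F w ∂(gibbs σ a θ c N Φ)
      = ∫⁻ pr, F (zipConfig pr) ∂(Q.prod Γ) := by rw [hlaw, lintegral_map hFm measurable_zipConfig]
    _ = ∫⁻ v, ∫⁻ x, F (zipConfig (x, v)) ∂Q ∂Γ :=
        lintegral_prod_symm _ (hFm.comp measurable_zipConfig).aemeasurable
    _ ≤ ∫⁻ v, Gv (v j) ∂Γ := lintegral_mono hsec
    _ = ∫⁻ p, Gv p ∂(gaussMeasure c θ) := by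
        rw [hΓ]
        have h1 := (measurePreserving_eval (fun _ : Fin (N + 1) => gaussMeasure c θ) j).lintegral_comp hGvm
        exact h1
    _ = 4 * volume (Metric.ball (0 : V3) 1) * ∫⁻ v, ENNReal.ofReal (ρ v ^ 3) * W v ∂(gaussMeasure c θ) := by
        rw [← lintegral_const_mul' _ _ (ENNReal.mul_ne_top (by norm_num) measure_ball_lt_top.ne)]
        refine lintegral_congr fun p => ?_
        rw [hGv]
        ring

end TrueCaps

end

end Summit.AtomisticToContinuum.HydrodynamicLimit.Theorems.TrueAnchoredInfection
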